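import Summits.ValiantsHypothesis.ValiantsHypothesis.Theorems.BinomialElusivePeelingLemmaWindowCalculus
import Summits.ValiantsHypothesis.ValiantsHypothesis.Theorems.BinomialElusivePeelingLemmaGadgetBlock

/-!
# The block theta gadget, III: private letters see only their own arm; local top / bottom letters

Helper for the crux stmt-ValiantsHypothesis-7391 (negative lane; `Cruxes/PeelingLemma/DETERMINISTIC-ALLX.md`
§3f, mechanism (M1) of the gadget local lemma [E]).  In the per-gadget charge combination
`Σ_j Σ_{t ∈ S} c_j(t) · win (birth3 j) q t` of the block gadget, a letter born on arm `j` in the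
private zone `2q+1 ≤ t ≤ 2q+no+1` (an `ord` or `ex` letter) receives contributions from arm `j` only
(`gadget_sum_apply_private_birth`); hence a private letter born at a charged position `t₁` above which
arm `j` carries no charge for `2q` steps has coefficient exactly `c_j(t₁) ≠ 0` (`gadget_sum_top`), and
dually for the letter dying just after a charged position `t₀` below which arm `j` is uncharged for
`2q` steps (`gadget_sum_bottom`).  These "tops" and "bottoms" are the uncancellable support letters of
[E].  Also: local (windowed) versions of `charge_sum_apply_top/bottom` for one arm.  No Theses import.
-/

namespace Summit.ValiantsHypothesis.ValiantsHypothesis.Theorems.PeelingLemmaGadget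

-- summit = sub-problem name (single-conjunct summit, D-0017 layout), so the namespace repeats it
set_option linter.dupNamespace false

open scoped BigOperators
open Finset
open Summit.ValiantsHypothesis.ValiantsHypothesis.Theorems.PeelingLemmaWindow

/-! ## One arm: letters outside the range, local top and bottom letters -/

section OneArm

variable {Λ : Type*} [DecidableEq Λ]

/-- A letter that is never born on the arm does not occur in any of its window vectors. -/
theorem win_eq_zero_of_forall_ne (f : ℤ → Λ) (q : ℕ) (t : ℤ) {ν : Λ} (h : ∀ τ, f τ ≠ ν) :
    win f q t ν = 0 := by
  unfold win
  exact Finset.sum_eq_zero fun i _ => by rw [if_neg (h _), mul_zero]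

/-- **Local top letter.**  If `t₁ ∈ S` and the positions of `S` in `(t₁, t₁ + 2q]` carry charge `0`,
the letter born at `t₁` has coefficient `c t₁` in `Σ_{t∈S} c t · win t`. -/
theorem charge_sum_apply_top_local {f : ℤ → Λ} (hf : Function.Injective f) (q : ℕ) (S : Finset ℤ)
    (c : ℤ → ℤ) {t₁ : ℤ} (ht₁ : t₁ ∈ S) (htop : ∀ t ∈ S, t₁ < t → t ≤ t₁ + 2 * q → c t = 0) :
    ∑ t ∈ S, c t * win f q t (f t₁) = c t₁ := by
  rw [charge_sum_apply_born hf, Finset.sum_eq_single_of_mem t₁]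
  · simp
  · exact Finset.mem_filter.mpr ⟨ht₁, le_refl _, by linarith⟩
  · intro t ht hne
    obtain ⟨htS, hτ, hτ'⟩ := Finset.mem_filter.mp ht
    rw [htop t htS (lt_of_le_of_ne hτ (Ne.symm hne)) hτ', mul_zero]

/-- **Local bottom letter.**  If `t₀ ∈ S` and the positions of `S` in `[t₀ - 2q, t₀)` carry charge
`0`, the letter `f (t₀ - 2q)` (of age `2q` at `t₀`) has coefficient `c t₀`. -/
theorem charge_sum_apply_bottom_local {f : ℤ → Λ} (hf : Function.Injective f) (q : ℕ)
    (S : Finset ℤ) (c : ℤ → ℤ) {t₀ : ℤ} (ht₀ : t₀ ∈ S)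
    (hbot : ∀ t ∈ S, t₀ - 2 * q ≤ t → t < t₀ → c t = 0) :
    ∑ t ∈ S, c t * win f q t (f (t₀ - 2 * q)) = c t₀ := by
  rw [charge_sum_apply_born hf, Finset.sum_eq_single_of_mem t₀]
  · have : (t₀ - (t₀ - 2 * (q : ℤ))).toNat = 2 * q := by
      rw [sub_sub_cancel]; exact_mod_cast Int.toNat_natCast (2 * q)
    rw [this, Even.neg_pow (even_two_mul q), one_pow, one_mul]
  · exact Finset.mem_filter.mpr ⟨ht₀, by linarith, by linarith⟩
  · intro t ht hne
    obtain ⟨htS, hτ, hτ'⟩ := Finset.mem_filter.mp ht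
    have htle : t ≤ t₀ := by linarith
    rw [hbot t htS hτ (lt_of_le_of_ne htle hne), mul_zero]

end OneArm

/-! ## The gadget: private letters see only their own arm -/

variable {q R no : ℕ}

/-- Letters born in the private zone `2q+1 ≤ τ ≤ 2q+no+1` of arm `j` (ordinary and extra letters)
are born on no other arm. -/
theorem birth3_private (j : Fin 5) {τ : ℤ} (h1 : (2 * q + 1 : ℤ) ≤ τ) (h2 : τ ≤ 2 * q + no + 1)
    {j' : Fin 5} (hj : j' ≠ j) (τ' : ℤ) : birth3 q R no j' τ' ≠ birth3 q R no j τ := by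
  intro h
  rcases birth3_shape (q := q) (R := R) (no := no) j τ with
    ⟨z, hb⟩ | ⟨-, h0, -, -⟩ | ⟨-, -, k, -, hb⟩ | ⟨-, hb⟩ | ⟨h0, -, -, -⟩
  · -- junk values occur only at negative positions or beyond b'
    have : τ < 0 ∨ (4 * q + no + 2 : ℤ) < τ := by
      by_contra hc
      push Not at hc
      have ht : τ = ((τ.toNat : ℕ) : ℤ) := (Int.toNat_of_nonneg hc.1).symm
      rw [ht, birth3_natCast] at hb
      rcases birthNat3_shape (q := q) (R := R) (no := no) j τ.toNat with
        ⟨-, a, h'⟩ | ⟨-, -, k, -, h'⟩ | ⟨-, h'⟩ | ⟨-, -, a, h'⟩ | ⟨h5, -⟩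
      all_goals first | (rw [h'] at hb; cases hb) | omega
    omega
  · omega
  · rw [hb, birth3_eq_ord_iff] at h; exact hj h.1
  · rw [hb, birth3_eq_ex_iff] at h; exact hj h.1
  · omega

/-- In the gadget charge combination, a letter born in the private zone of arm `j` receives
contributions from arm `j` only. -/
theorem gadget_sum_apply_private_birth (c : Fin 5 → ℤ → ℤ) (S : Finset ℤ) (j : Fin 5) {τ : ℤ}
    (h1 : (2 * q + 1 : ℤ) ≤ τ) (h2 : τ ≤ 2 * q + no + 1) :
    (∑ j', ∑ t ∈ S, c j' t * win (birth3 q R no j') q t (birth3 q R no j τ)) =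
      ∑ t ∈ S, c j t * win (birth3 q R no j) q t (birth3 q R no j τ) := by
  rw [Finset.sum_eq_single_of_mem j (Finset.mem_univ j)]
  intro j' _ hj
  exact Finset.sum_eq_zero fun t _ => by
    rw [win_eq_zero_of_forall_ne _ q t (birth3_private j h1 h2 hj), mul_zero]

/-- **(M1) Top letters are uncancellable.**  If arm `j` is charged at a private-zone position
`t₁ ∈ S` and uncharged at the positions of `S` in `(t₁, t₁+2q]`, the letter born at `t₁` on arm `j`
has coefficient exactly `c j t₁` in the gadget combination — whatever the other arms carry. -/
theorem gadget_sum_top (c : Fin 5 → ℤ → ℤ) (S : Finset ℤ) (j : Fin 5) {t₁ : ℤ} (ht₁ : t₁ ∈ S)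
    (h1 : (2 * q + 1 : ℤ) ≤ t₁) (h2 : t₁ ≤ 2 * q + no + 1)
    (htop : ∀ t ∈ S, t₁ < t → t ≤ t₁ + 2 * q → c j t = 0) :
    (∑ j', ∑ t ∈ S, c j' t * win (birth3 q R no j') q t (birth3 q R no j t₁)) = c j t₁ := by
  rw [gadget_sum_apply_private_birth c S j h1 h2]
  exact charge_sum_apply_top_local (birth3_injective j) q S (c j) ht₁ htop

/-- **(M1') Bottom letters are uncancellable.**  If arm `j` is charged at `t₀ ∈ S` with
`4q+1 ≤ t₀ ≤ 4q+no+1` (so that the letter of age `2q` at `t₀` is a private letter) and uncharged at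
the positions of `S` in `[t₀-2q, t₀)`, that letter has coefficient exactly `c j t₀`. -/
theorem gadget_sum_bottom (c : Fin 5 → ℤ → ℤ) (S : Finset ℤ) (j : Fin 5) {t₀ : ℤ} (ht₀ : t₀ ∈ S)
    (h1 : (4 * q + 1 : ℤ) ≤ t₀) (h2 : t₀ ≤ 4 * q + no + 1)
    (hbot : ∀ t ∈ S, t₀ - 2 * q ≤ t → t < t₀ → c j t = 0) :
    (∑ j', ∑ t ∈ S, c j' t * win (birth3 q R no j') q t (birth3 q R no j (t₀ - 2 * q))) = c j t₀ := by
  rw [gadget_sum_apply_private_birth c S j (by omega) (by omega)]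
  exact charge_sum_apply_bottom_local (birth3_injective j) q S (c j) ht₀ hbot

/-- The top letters of two different arms are different letters (private zones are disjoint). -/
theorem birth3_private_ne (j j' : Fin 5) (hj : j ≠ j') {τ τ' : ℤ} (h1 : (2 * q + 1 : ℤ) ≤ τ)
    (h2 : τ ≤ 2 * q + no + 1) : birth3 q R no j τ ≠ birth3 q R no j' τ' :=
  fun h => birth3_private j h1 h2 (Ne.symm hj) τ' h.symm

end Summit.ValiantsHypothesis.ValiantsHypothesis.Theorems.PeelingLemmaGadget
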